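/-
Copyright: rh-split cell (nb, neg) gen 18, 2026-08-27.  Splitting search over kernel-typed
RH-equivalences.  A splitting `A ∧ B ⟹ RH` is CONDITIONAL bookkeeping unless `A` and `B` are both
proved; nothing here bears on the truth of RH.
-/
import Summits.RiemannHypothesis.RiemannHypothesis.Theorems.Splittings.NbTruncationB
import HarnessLib

/-!
# Truncating ζ in the Nyman–Beurling distance is decided RH-free (nb/neg V43) — part C

Continuation of `NbTruncationB` (same namespace `…Splittings.NbTruncation`; the module docstring of
`NbTruncationA` states the objects, the census row and the theorem map for all parts).  Content below is the
original one-file kernel VERBATIM (lines 707–1013 of the uncarved file).  No `sorry`, no new axioms, no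
definitions, no instances, no notation.
-/

noncomputable section

set_option linter.dupNamespace false
open Complex MeasureTheory Set Filter
open scoped Real ENNReal

namespace Summit.RiemannHypothesis.RiemannHypothesis.Theorems.Splittings.NbTruncation

open Summit.RiemannHypothesis.RiemannHypothesis.Theses.NymanBeurling
open Summit.RiemannHypothesis.RiemannHypothesis.Theorems
open Literature.NumberTheory.LFunctions
open Literature.Barriers.RiemannHypothesis
open ArithmeticFunction

/-- `(n : ℂ)^{-σ}` for a natural number `n` and real `σ` is the real power. [folklore]
(file-internal copy; the landed twin is
`Literature.Barriers.RiemannHypothesis.cpow_neg_ofReal_natCast`). -/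
private theorem natCast_cpow_neg_ofReal (n : ℕ) (σ : ℝ) :
    (n : ℂ) ^ (-(σ : ℂ)) = (((n : ℝ) ^ (-σ) : ℝ) : ℂ) := by
  rw [← ofReal_neg, ← ofReal_natCast, ← ofReal_cpow (Nat.cast_nonneg n)]

/-- `(n : ℂ)^{-1/2} = √n / n` for `n ≥ 1`. [folklore] -/
theorem natCast_cpow_neg_half {n : ℕ} (hn : 0 < n) :
    (n : ℂ) ^ (-((1 / 2 : ℝ) : ℂ)) = ((Real.sqrt n / n : ℝ) : ℂ) := by
  rw [natCast_cpow_neg_ofReal, rpow_neg_half_eq_sqrt_div (by exact_mod_cast hn)]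

/-- `(√p / p)² = 1/p`. [folklore] -/
theorem sqrt_div_self_sq {p : ℝ} (hp : 0 < p) : (Real.sqrt p / p) ^ 2 = 1 / p := by
  rw [div_pow, Real.sq_sqrt hp.le]
  field_simp

/-- **Spira's criterion from an arbitrary abscissa `σ₁ ≤ 2`** (Spira 1968, §4 p. 173, run at `σ₁`
instead of `1`): `N ≥ 1`; `Icc 1 N = G ∪ P` with `P` a nonempty set of primes none of which divides
an element of `G`; `f` unimodular at the primes; if `‖∑_{n ∈ G} f̃(n) n^{-σ₁}‖ < ∑_{p ∈ P} p^{-σ₁}`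
then `ζ_N(s) = 0` for some `s` with `Re s > σ₁`. Proof: `g(σ) = ‖∑_G f̃(n)n^{-σ}‖ - ∑_P p^{-σ}` is
continuous, negative at `σ₁`, `≥ 1/N ≥ 0` at `2`; at a zero `σ₀ ∈ (σ₁, 2]` of `g` re-phase `f` on
`P` against `∑_G`, so the twisted section VANISHES at `σ₀`, and Bohr's transfer
`exists_zetaPartialSum_zero_of_twist_zero` gives zeros of `ζ_N` with `Re s > σ₁`.
[cite: Spira1968, §4 p. 173 and §2] [cite: Apostol1990, §8.11 Thm. 8.16] -/
theorem exists_zetaPartialSum_zero_of_spira_criterion_at {N : ℕ} (hN : 1 ≤ N) {σ₁ : ℝ}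
    (hσ₁ : σ₁ ≤ 2) (f : ℕ → ℂ) (hf : ∀ p : ℕ, p.Prime → ‖f p‖ = 1) (G P : Finset ℕ)
    (hU : Finset.Icc 1 N = G ∪ P) (hP : ∀ p ∈ P, p.Prime) (hPne : P.Nonempty)
    (hG : ∀ n ∈ G, ∀ q ∈ n.primeFactorsList, q ∉ P)
    (hcrit : ‖∑ n ∈ G, primeTwist f n * (n : ℂ) ^ (-(σ₁ : ℂ))‖ < ∑ p ∈ P, (p : ℝ) ^ (-σ₁)) :
    ∃ s : ℂ, zetaPartialSum N s = 0 ∧ σ₁ < s.re := by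
  classical
  have hP0 : ∀ p ∈ P, (0 : ℝ) < p := fun p hp ↦ by exact_mod_cast (hP p hp).pos
  have hD : Disjoint G P := by
    rw [Finset.disjoint_left]
    intro n hnG hnP
    have hn := hP n hnP
    exact hG n hnG n ((Nat.mem_primeFactorsList hn.ne_zero).2 ⟨hn, dvd_rfl⟩) hnP
  have hG0 : ∀ n ∈ G, n ≠ 0 := by
    intro n hn h0
    have : n ∈ Finset.Icc 1 N := by rw [hU]; exact Finset.mem_union_left P hn
    rw [Finset.mem_Icc] at this
    omega
  have h1G : 1 ∈ G := by
    have : 1 ∈ Finset.Icc 1 N := by simp [hN]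
    rw [hU, Finset.mem_union] at this
    rcases this with h | h
    · exact h
    · exact absurd (hP 1 h) Nat.not_prime_one
  set Fs : ℝ → ℂ := fun σ ↦ ∑ n ∈ G, primeTwist f n * (n : ℂ) ^ (-(σ : ℂ)) with hFs
  set R : ℝ → ℝ := fun σ ↦ ∑ p ∈ P, (p : ℝ) ^ (-σ) with hR
  have hFc : Continuous Fs := by
    refine continuous_finsetSum _ fun n hn ↦ continuous_const.mul ?_
    exact Continuous.const_cpow continuous_ofReal.neg (Or.inl (by exact_mod_cast hG0 n hn))
  have hRc : Continuous R := by
    refine continuous_finsetSum _ fun p hp ↦ ?_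
    exact continuous_const.rpow continuous_neg fun _ ↦ Or.inl (hP0 p hp).ne'
  set g : ℝ → ℝ := fun σ ↦ ‖Fs σ‖ - R σ with hg
  have hgc : Continuous g := hFc.norm.sub hRc
  have hg1 : g σ₁ < 0 := by
    simp only [hg, hFs, hR]
    linarith
  have hg2 : 0 ≤ g 2 := by
    have hIcc := sum_Icc_rpow_neg_two_le hN
    have hsplit : ∑ n ∈ Finset.Icc 1 N, (n : ℝ) ^ (-(2 : ℝ)) =
        ∑ n ∈ G, (n : ℝ) ^ (-(2 : ℝ)) + R 2 := by
      rw [hU, Finset.sum_union hD]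
    have eG : ∑ n ∈ G, (n : ℝ) ^ (-(2 : ℝ)) = 1 + ∑ n ∈ G.erase 1, (n : ℝ) ^ (-(2 : ℝ)) := by
      rw [← Finset.add_sum_erase G _ h1G]
      simp
    have e : Fs 2 = 1 + ∑ n ∈ G.erase 1, primeTwist f n * (n : ℂ) ^ (-((2 : ℝ) : ℂ)) := by
      simp only [hFs]
      rw [← Finset.add_sum_erase G _ h1G]
      simp
    have hb : ‖∑ n ∈ G.erase 1, primeTwist f n * (n : ℂ) ^ (-((2 : ℝ) : ℂ))‖ ≤
        ∑ n ∈ G.erase 1, (n : ℝ) ^ (-(2 : ℝ)) := by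
      refine norm_sum_le_of_le _ fun n hn ↦ ?_
      have hn0 : 0 < n := Nat.pos_of_ne_zero (hG0 n (Finset.mem_of_mem_erase hn))
      rw [norm_mul, norm_primeTwist f hf, one_mul, Complex.norm_natCast_cpow_of_pos hn0]
      simp
    have hF2 : 2 - ∑ n ∈ G, (n : ℝ) ^ (-(2 : ℝ)) ≤ ‖Fs 2‖ := by
      rw [e, eG]
      have := norm_sub_norm_le (1 : ℂ)
        (-(∑ n ∈ G.erase 1, primeTwist f n * (n : ℂ) ^ (-((2 : ℝ) : ℂ))))
      rw [sub_neg_eq_add, norm_one, norm_neg] at this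
      linarith
    have hN' : (0 : ℝ) < 1 / (N : ℝ) := by
      have : (0 : ℝ) < N := by exact_mod_cast hN
      positivity
    simp only [hg]
    linarith
  obtain ⟨σ₀, hσ₀, hzero⟩ := intermediate_value_Icc hσ₁ hgc.continuousOn ⟨hg1.le, hg2⟩
  have hσ₀1 : σ₁ < σ₀ := by
    rcases eq_or_lt_of_le hσ₀.1 with h | h
    · exfalso; rw [← h] at hzero; linarith
    · exact h
  have hRpos : 0 < R σ₀ := Finset.sum_pos (fun p hp ↦ Real.rpow_pos_of_pos (hP0 p hp) _) hPne
  have hnorm : ‖Fs σ₀‖ = R σ₀ := by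
    have : g σ₀ = 0 := hzero
    simp only [hg] at this
    linarith
  have hF0 : Fs σ₀ ≠ 0 := by
    intro h; rw [h, norm_zero] at hnorm; linarith
  have hFn0 : (‖Fs σ₀‖ : ℂ) ≠ 0 := by exact_mod_cast (norm_ne_zero_iff.2 hF0)
  set u : ℂ := Fs σ₀ / (‖Fs σ₀‖ : ℂ) with hu
  have hun : ‖u‖ = 1 := by
    rw [hu, norm_div, Complex.norm_real, Real.norm_eq_abs, abs_of_pos (norm_pos_iff.2 hF0),
      div_self (norm_ne_zero_iff.2 hF0)]
  set f' : ℕ → ℂ := fun p ↦ if p ∈ P then -u else f p with hf'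
  have hf'1 : ∀ p : ℕ, p.Prime → ‖f' p‖ = 1 := by
    intro p hp
    by_cases h : p ∈ P
    · simp [hf', h, hun]
    · simp [hf', h, hf p hp]
  have hmul : ∀ m n : ℕ, m ≠ 0 → n ≠ 0 →
      primeTwist f' (m * n) = primeTwist f' m * primeTwist f' n :=
    fun m n hm hn ↦ primeTwist_mul f' hm hn
  have hψ : ∀ p : ℕ, p.Prime → ‖primeTwist f' p‖ = 1 := fun p hp ↦ by
    rw [primeTwist_prime f' hp]; exact hf'1 p hp
  have hvan : twistedPartialSum (primeTwist f') N (σ₀ : ℂ) = 0 := by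
    rw [twistedPartialSum, hU, Finset.sum_union hD]
    have eG : ∑ n ∈ G, primeTwist f' n * (n : ℂ) ^ (-(σ₀ : ℂ)) = Fs σ₀ := by
      refine Finset.sum_congr rfl fun n hn ↦ ?_
      rw [primeTwist_congr (g := f) fun q hq ↦ by simp [hf', hG n hn q hq]]
    have eP : ∑ p ∈ P, primeTwist f' p * (p : ℂ) ^ (-(σ₀ : ℂ)) = -u * (R σ₀ : ℂ) := by
      simp only [hR]
      rw [ofReal_sum, Finset.mul_sum]
      refine Finset.sum_congr rfl fun p hp ↦ ?_
      rw [primeTwist_prime f' (hP p hp)]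
      simp only [hf', if_pos hp]
      rw [ofReal_cpow (hP0 p hp).le, ofReal_natCast, ofReal_neg]
    rw [eG, eP, show ((R σ₀ : ℝ) : ℂ) = (‖Fs σ₀‖ : ℂ) by rw [hnorm], hu]
    field_simp
    ring
  obtain ⟨s, hs0, hs1, -⟩ := exists_zetaPartialSum_zero_of_twist_zero hmul hψ hN hvan (c := σ₁)
    (by simpa using hσ₀1) 0
  exact ⟨s, hs0, hs1⟩

/-- From `|Re v| ≤ A`, `|Im v| ≤ B` and `A² + B² < c²` (`0 ≤ c`): `‖v‖ < c`. [folklore] -/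
theorem norm_lt_of_abs_re_im_le {v : ℂ} {A B c : ℝ} (hre : |v.re| ≤ A) (him : |v.im| ≤ B)
    (hc : 0 ≤ c) (h : A ^ 2 + B ^ 2 < c ^ 2) : ‖v‖ < c := by
  refine lt_of_pow_lt_pow_left₀ 2 hc ?_
  rw [Complex.sq_norm, Complex.normSq_apply]
  nlinarith [sq_le_sq' (abs_le.1 hre).1 (abs_le.1 hre).2,
    sq_le_sq' (abs_le.1 him).1 (abs_le.1 him).2]

/-- **`ζ_4` has a zero with `σ > 1/2` (T44e)**: Spira's criterion at `σ₁ = 1/2` with the free prime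
`3` and the phase `f(2) = (-3-4i)/5`: `|1 + f(2)/√2 + f(2)²/2| ≈ 0.444 < 0.577 = 3^{-1/2}`.
(Every real twist of `ζ_4` is positive for `σ > 0`; the minimum over the torus is `≈ 0.433`.)
[cite: Spira1968, §4 p. 173] -/
theorem exists_zero_gt_half_four : ∃ ρ : ℂ, zetaPartialSum 4 ρ = 0 ∧ 1 / 2 < ρ.re := by
  obtain ⟨l2, u2, l3, u3, e4, -⟩ := sqrt_table
  set f : ℕ → ℂ := fun p ↦ if p = 2 then ((-3/5 : ℝ) : ℂ) + ((-4/5 : ℝ) : ℂ) * I else 1 with hf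
  have hf1 : ∀ p : ℕ, p.Prime → ‖f p‖ = 1 := by
    intro p _
    simp only [hf]
    split_ifs
    · exact norm_ofReal_add_mul_I_of_sq (by norm_num)
    · exact norm_one
  have hP : ∀ p ∈ ({3} : Finset ℕ), p.Prime := by
    intro p hp
    rw [Finset.mem_singleton] at hp
    subst hp
    norm_num
  have hG : ∀ n ∈ ({1, 2, 4} : Finset ℕ), ∀ q ∈ n.primeFactorsList, q ∉ ({3} : Finset ℕ) := by
    intro n hn
    simp only [Finset.mem_insert, Finset.mem_singleton] at hn
    rcases hn with rfl | rfl | rfl <;> simp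
  have hconv : ∑ n ∈ ({1, 2, 4} : Finset ℕ), primeTwist f n * (n : ℂ) ^ (-((1 / 2 : ℝ) : ℂ)) =
      ∑ n ∈ ({1, 2, 4} : Finset ℕ), primeTwist f n * ((Real.sqrt n / n : ℝ) : ℂ) := by
    refine Finset.sum_congr rfl fun n hn ↦ ?_
    simp only [Finset.mem_insert, Finset.mem_singleton] at hn
    rw [natCast_cpow_neg_half (by rcases hn with rfl | rfl | rfl <;> norm_num)]
  have hre : |(∑ n ∈ ({1, 2, 4} : Finset ℕ), primeTwist f n * ((Real.sqrt n / n : ℝ) : ℂ)).re| ≤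
      11 / 25 := by
    simp only [hf, primeTwist]
    simp [Finset.sum_insert, e4]
    rw [abs_le]
    constructor <;> linarith
  have him : |(∑ n ∈ ({1, 2, 4} : Finset ℕ), primeTwist f n * ((Real.sqrt n / n : ℝ) : ℂ)).im| ≤
      9 / 100 := by
    simp only [hf, primeTwist]
    simp [Finset.sum_insert, e4]
    rw [abs_le]
    constructor <;> linarith
  have hR : ∑ p ∈ ({3} : Finset ℕ), (p : ℝ) ^ (-(1 / 2 : ℝ)) = Real.sqrt 3 / 3 := by
    rw [Finset.sum_singleton, Nat.cast_ofNat, rpow_neg_half_eq_sqrt_div (by norm_num)]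
  have hcrit : ‖∑ n ∈ ({1, 2, 4} : Finset ℕ), primeTwist f n * (n : ℂ) ^ (-((1 / 2 : ℝ) : ℂ))‖ <
      ∑ p ∈ ({3} : Finset ℕ), (p : ℝ) ^ (-(1 / 2 : ℝ)) := by
    rw [hconv, hR]
    refine norm_lt_of_abs_re_im_le hre him (by positivity) ?_
    rw [sqrt_div_self_sq (by norm_num)]
    norm_num
  exact exists_zetaPartialSum_zero_of_spira_criterion_at (by norm_num) (by norm_num) f hf1 _ _
    (by decide) hP ⟨3, by simp⟩ hG hcrit

/-- **`ζ_6` has a zero with `σ > 1/2` (T44e)**: Spira's criterion at `σ₁ = 1/2`, free prime `5`,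
phases `f(2) = (-3-4i)/5`, `f(3) = (-4-3i)/5`: `|∑_{n ∈ {1,2,3,4,6}} f̃(n)/√n| ≈ 0.035 < 0.447`.
[cite: Spira1968, §4 p. 173] -/
theorem exists_zero_gt_half_six : ∃ ρ : ℂ, zetaPartialSum 6 ρ = 0 ∧ 1 / 2 < ρ.re := by
  obtain ⟨l2, u2, l3, u3, e4, l5, u5, l6, u6, -⟩ := sqrt_table
  set f : ℕ → ℂ := fun p ↦
    if p = 2 then ((-3/5 : ℝ) : ℂ) + ((-4/5 : ℝ) : ℂ) * I else
    if p = 3 then ((-4/5 : ℝ) : ℂ) + ((-3/5 : ℝ) : ℂ) * I else 1 with hf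
  have hf1 : ∀ p : ℕ, p.Prime → ‖f p‖ = 1 := by
    intro p _
    simp only [hf]
    split_ifs
    · exact norm_ofReal_add_mul_I_of_sq (by norm_num)
    · exact norm_ofReal_add_mul_I_of_sq (by norm_num)
    · exact norm_one
  have hP : ∀ p ∈ ({5} : Finset ℕ), p.Prime := by
    intro p hp
    rw [Finset.mem_singleton] at hp
    subst hp
    norm_num
  have hG : ∀ n ∈ ({1, 2, 3, 4, 6} : Finset ℕ), ∀ q ∈ n.primeFactorsList,
      q ∉ ({5} : Finset ℕ) := by
    intro n hn
    simp only [Finset.mem_insert, Finset.mem_singleton] at hn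
    rcases hn with rfl | rfl | rfl | rfl | rfl <;> simp
  have hconv : ∑ n ∈ ({1, 2, 3, 4, 6} : Finset ℕ), primeTwist f n * (n : ℂ) ^ (-((1 / 2 : ℝ) : ℂ)) =
      ∑ n ∈ ({1, 2, 3, 4, 6} : Finset ℕ), primeTwist f n * ((Real.sqrt n / n : ℝ) : ℂ) := by
    refine Finset.sum_congr rfl fun n hn ↦ ?_
    simp only [Finset.mem_insert, Finset.mem_singleton] at hn
    rw [natCast_cpow_neg_half (by rcases hn with rfl | rfl | rfl | rfl | rfl <;> norm_num)]
  have hre : |(∑ n ∈ ({1, 2, 3, 4, 6} : Finset ℕ),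
      primeTwist f n * ((Real.sqrt n / n : ℝ) : ℂ)).re| ≤ 1 / 10 := by
    simp only [hf, primeTwist]
    simp [Finset.sum_insert, e4]
    rw [abs_le]
    constructor <;> linarith
  have him : |(∑ n ∈ ({1, 2, 3, 4, 6} : Finset ℕ),
      primeTwist f n * ((Real.sqrt n / n : ℝ) : ℂ)).im| ≤ 1 / 10 := by
    simp only [hf, primeTwist]
    simp [Finset.sum_insert, e4]
    rw [abs_le]
    constructor <;> linarith
  have hR : ∑ p ∈ ({5} : Finset ℕ), (p : ℝ) ^ (-(1 / 2 : ℝ)) = Real.sqrt 5 / 5 := by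
    rw [Finset.sum_singleton, Nat.cast_ofNat, rpow_neg_half_eq_sqrt_div (by norm_num)]
  have hcrit : ‖∑ n ∈ ({1, 2, 3, 4, 6} : Finset ℕ),
      primeTwist f n * (n : ℂ) ^ (-((1 / 2 : ℝ) : ℂ))‖ <
      ∑ p ∈ ({5} : Finset ℕ), (p : ℝ) ^ (-(1 / 2 : ℝ)) := by
    rw [hconv, hR]
    refine norm_lt_of_abs_re_im_le hre him (by positivity) ?_
    rw [sqrt_div_self_sq (by norm_num)]
    norm_num
  exact exists_zetaPartialSum_zero_of_spira_criterion_at (by norm_num) (by norm_num) f hf1 _ _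
    (by decide) hP ⟨5, by simp⟩ hG hcrit

/-- **`ζ_{10}` has a zero with `σ > 1/2` (T44e)**: Spira's criterion at `σ₁ = 1/2`, free prime `7`,
phases `f(2) = (-24-7i)/25`, `f(3) = (-7-24i)/25`, `f(5) = (-4+3i)/5`:
`|∑_{n ≤ 10, 7 ∤ n} f̃(n)/√n| ≈ 0.007 < 0.378 = 7^{-1/2}`. [cite: Spira1968, §4 p. 173] -/
theorem exists_zero_gt_half_ten : ∃ ρ : ℂ, zetaPartialSum 10 ρ = 0 ∧ 1 / 2 < ρ.re := by
  obtain ⟨l2, u2, l3, u3, e4, l5, u5, l6, u6, l7, u7, l8, u8, e9, l10, u10, -⟩ := sqrt_table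
  set f : ℕ → ℂ := fun p ↦
    if p = 2 then ((-24/25 : ℝ) : ℂ) + ((-7/25 : ℝ) : ℂ) * I else
    if p = 3 then ((-7/25 : ℝ) : ℂ) + ((-24/25 : ℝ) : ℂ) * I else
    if p = 5 then ((-4/5 : ℝ) : ℂ) + ((3/5 : ℝ) : ℂ) * I else 1 with hf
  have hf1 : ∀ p : ℕ, p.Prime → ‖f p‖ = 1 := by
    intro p _
    simp only [hf]
    split_ifs
    · exact norm_ofReal_add_mul_I_of_sq (by norm_num)
    · exact norm_ofReal_add_mul_I_of_sq (by norm_num)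
    · exact norm_ofReal_add_mul_I_of_sq (by norm_num)
    · exact norm_one
  have hP : ∀ p ∈ ({7} : Finset ℕ), p.Prime := by
    intro p hp
    rw [Finset.mem_singleton] at hp
    subst hp
    norm_num
  have hG : ∀ n ∈ ({1, 2, 3, 4, 5, 6, 8, 9, 10} : Finset ℕ), ∀ q ∈ n.primeFactorsList,
      q ∉ ({7} : Finset ℕ) := by
    intro n hn
    simp only [Finset.mem_insert, Finset.mem_singleton] at hn
    rcases hn with rfl | rfl | rfl | rfl | rfl | rfl | rfl | rfl | rfl <;> simp
  have hconv : ∑ n ∈ ({1, 2, 3, 4, 5, 6, 8, 9, 10} : Finset ℕ),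
      primeTwist f n * (n : ℂ) ^ (-((1 / 2 : ℝ) : ℂ)) =
      ∑ n ∈ ({1, 2, 3, 4, 5, 6, 8, 9, 10} : Finset ℕ),
        primeTwist f n * ((Real.sqrt n / n : ℝ) : ℂ) := by
    refine Finset.sum_congr rfl fun n hn ↦ ?_
    simp only [Finset.mem_insert, Finset.mem_singleton] at hn
    rw [natCast_cpow_neg_half
      (by rcases hn with rfl | rfl | rfl | rfl | rfl | rfl | rfl | rfl | rfl <;> norm_num)]
  have hre : |(∑ n ∈ ({1, 2, 3, 4, 5, 6, 8, 9, 10} : Finset ℕ),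
      primeTwist f n * ((Real.sqrt n / n : ℝ) : ℂ)).re| ≤ 1 / 10 := by
    simp only [hf, primeTwist]
    simp [Finset.sum_insert, e4, e9]
    rw [abs_le]
    constructor <;> linarith
  have him : |(∑ n ∈ ({1, 2, 3, 4, 5, 6, 8, 9, 10} : Finset ℕ),
      primeTwist f n * ((Real.sqrt n / n : ℝ) : ℂ)).im| ≤ 1 / 10 := by
    simp only [hf, primeTwist]
    simp [Finset.sum_insert, e4, e9]
    rw [abs_le]
    constructor <;> linarith
  have hR : ∑ p ∈ ({7} : Finset ℕ), (p : ℝ) ^ (-(1 / 2 : ℝ)) = Real.sqrt 7 / 7 := by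
    rw [Finset.sum_singleton, Nat.cast_ofNat, rpow_neg_half_eq_sqrt_div (by norm_num)]
  have hcrit : ‖∑ n ∈ ({1, 2, 3, 4, 5, 6, 8, 9, 10} : Finset ℕ),
      primeTwist f n * (n : ℂ) ^ (-((1 / 2 : ℝ) : ℂ))‖ <
      ∑ p ∈ ({7} : Finset ℕ), (p : ℝ) ^ (-(1 / 2 : ℝ)) := by
    rw [hconv, hR]
    refine norm_lt_of_abs_re_im_le hre him (by positivity) ?_
    rw [sqrt_div_self_sq (by norm_num)]
    norm_num
  exact exists_zetaPartialSum_zero_of_spira_criterion_at (by norm_num) (by norm_num) f hf1 _ _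
    (by decide) hP ⟨7, by simp⟩ hG hcrit


end Summit.RiemannHypothesis.RiemannHypothesis.Theorems.Splittings.NbTruncation

end
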